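import Summits.ABC.IUTFork.Repair.CandInternal2Tests
import Summits.ABC.IUTFork.Cor312PinnedFrameFlip
import HarnessLib

/-!
# IUT REPAIR BRANCH (rung LADDER-ABC:A2.RP), class (i) INTERNAL, sub-cell B0, seat rp-d2 — `CandInternal8`: row RP-I06d «q-pilot Kummer image
# ⊆ log-shell ⊆ hull» split into its FAITHFUL q-side half and its Θ-side inflation half, with the class NO-GO for the inflation half under
# honest nesting; and the family form of RP-I06b's (T-c)

Record file (D-0012) of the abc-iut cell, IUT REPAIR branch (plan/repair/REPAIR-SPEC.md v0.3 §6 «Typing consequence: … route H to the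
HULL/S level (inflation claims + the faithful q-side fact «q-pilot Kummer image ⊆ log-shell»; REPAIRED⁺ possible; T-d must name the inflation
bound the source asserts)»; seat abc-iut-rp-d2, k = 8 ≡ 2 mod 3). TAKES NO SIDE on [IUTchIII] Cor. 3.12 or on any author. The candidates
below are `Prop`-valued DEFINITIONS over the frozen binders `S`, `P`, `ρ`, `qK` — hypotheses, never asserted; typed ≠ proved. Sequel to
`CandInternal2` (p427942), `CandInternal2Tests` (p428214), `CandInternal5` (RP-I06c). DEFS-FREEZE respected; no fact consumed; standard axioms.

THE ROW (abc-iut-rp-plan's original wording of RP-I06: «upper semi-compatibility applied to BOTH pilots in column n+1: q-pilot Kummer image ⊆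
log-shell ⊆ hull»), typed as the conjunction of
* `HQInShell S P ρ qK` — «the q-pilot's Kummer-image region lies in the mono-analytic integral structure / log-shell `MRData.shellPk` of the
  line» — the FAITHFUL q-SIDE FACT: the q-parameter is a nonzero NON-UNIT INTEGRAL element, so `q_v·𝒪 ⊆ 𝒪 ⊆ 𝓘` ([IUTchI] `paper:url-690e7b3c6199`
  Def. 3.1 (b) «q-parameters» of `E_F` at `v ∈ 𝕍^bad`; [IUTchIII] `paper:url-4b091feeb646` Prop. 3.5 (ii) (a) p. 104–105 / Thm. 3.11 (ii) (Ind3)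
  p. 156 l. 33–40 «natural inclusions ⊆» into `𝓘(…)`); it HOLDS at the pinned countermodel (`B_1 ⊆ B_0`) — honest and idle;
* `HShellInHull S P` — «the log-shell ITSELF lies in the holomorphic hull ⁿ˒°𝒰_{j,v_ℚ} of the possible Θ-images» — a Θ-SIDE-ONLY INFLATION
  CLAIM (it does not read `qK`): NOT-IN-PRINT as such ([IUTchIV] `paper:url-56bcb0f95768` Thm. 1.10 Step (v) p. 27 l. 57–71 bounds the hull
  FROM ABOVE by a log-shell multiple «p^{⌊λ−d_I−a_I⌋}·log_p(R^×_I)» ⊇ union of possible images; it never places the unit log-shell INSIDE the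
  hull, whose natural size is `q^{j²}`-scaled).
RESULTS. §1 (T-a) `hull_of_H : HQInShell → HShellInHull → Cor312Vol.PilotKummerCompatHull` (two inclusions), `statement_of_H` via V-H, the
three-pin / typed-Thm-3.11 shapes, `gapH3_of_H`. §2 **THE CLASS NO-GO FOR THE INFLATION HALF (`qLocal_nonneg_of_hShellInHull`,
`not_absLogQPos_of_hShellInHull`)**: at ANY setting in which (N) every possible Θ-image lies inside the q-image («honest nesting»:
`q^{j²}·(anything integral) ⊆ q·𝒪` for `j ≥ 1` — true in every arithmetic holomorphic structure and at every model of record), (M) the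
log-volume is monotone on admissible regions (`Cor312Vol.LogvolMono`, a bridge hypothesis), (A) the log-shell is admissible and (Z) has
NONNEGATIVE log-volume (print's normalisation `μ^log(𝒪) = 0`, `𝓘 ⊇ 𝒪`: [IUTchIII] Prop. 3.9 (i)–(ii); [AbsTopIII] Prop. 5.7), `HShellInHull`
forces `0 ≤ qLocal` in every packet of `𝔽_l^⋇`, hence `¬ AbsLogQPos` (`−|log(q)| ≥ 0`): the Θ-hull lies inside the q-image (the q-image is a
hull-set containing every possible image), so a log-shell inside the hull would sit inside `q·𝒪`. So the inflation half can hold only where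
the Θ-images are NOT nested in the q-image (inflated Θ-REGIONS, as on LS with `d ≥ 4`) — never together with exact `j²`-scaled Θ-regions
inside `q·𝒪` and `|log(q)| > 0`; in particular it FAILS at the SAT+ model of record `flipSetting` (`not_hShellInHull_flip`). §3 (T-b)/(LS)
at the models of record: `HQInShell` HOLDS at the pinned countermodel and along LS (`hQInShell_pinnedSetting`, `hQInShell_shell`);
`HShellInHull` FAILS at the countermodel (`not_hShellInHull_pinnedSetting`) and holds on LS iff `4 ≤ d` (`hShellInHull_shell_iff`:
«inflation ≥ 4 × height», one more than RP-I06's `3`); the conjunction `H` is satisfiable with the pins and typed Thm. 3.11 at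
`shellSetting 2 4` (`H_satisfiable`, grade SAT⊖ proposed: Θ-regions inflated, not exactly `j²`-scaled) and never SAT+ (§2). §4 the family
form of RP-I06b's (T-c): `not_hQShellOrbitData_naive` — the DATA-LEVEL log-shell candidate of `CandInternal2` is false at EVERY setting over
abc-iut-w5-d247's `naiveFull p` with the computed q-datum (the typed log-shell there is `𝒪` and `q ∉ q⁴·𝒪`), whatever the glue, frame or
operator — «UNSAT on the family of record», which is NOT «contradicts the typed interface» (the typed Thm. 3.11 leaves the log-shell index free).
[claim: Mochizuki2012, status: disputed] [cite: ScholzeStix2018, §2.2 pp. 9–10]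
-/

noncomputable section

open Set

namespace Summit.ABC.IUTFork.Repair.CandInternal8

open Thm311 Cor312 Cor312Vol Literature.IUT.LogThetaLattice Summit.ABC.IUTFork.Repair.CandInternal2
  Summit.ABC.IUTFork.Repair.CandInternal2Tests

/-! ## 1. The two halves of RP-I06d and (T-a) -/

section General

variable {T : ThetaIndex} (S : LatticeSituation T) (P : Cor312.Setting S.toSituation)
  (ρ : (∀ v : T.V, v ∈ T.Vbad → Set (S.L.StarPacket v)) → ∀ (j : T.Label) (vQ : T.VQ), Set (S.L.Packet j vQ))
  (qK : ∀ v : T.V, v ∈ T.Vbad → Set (S.L.StarPacket v))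

/-- **CANDIDATE RP-I06d, q-SIDE HALF `HQInShell` (class Internal, B0) — hypothesis, NOT asserted; typed ≠ proved.** «The q-pilot's
Kummer-image region lies in the mono-analytic integral structure (log-shell) of the line»: `ρ qK j v_ℚ ⊆ 𝓘(^{S^±_{j+1}};^{n,∘}𝒟⊢_{v_ℚ})` =
`MRData.shellPk`. SOURCE (FAITHFUL q-side fact): the q-parameter is a nonzero non-unit integral element ([IUTchI] `paper:url-690e7b3c6199`
Def. 3.1 (b)); (Ind3)'s containers [IUTchIII] `paper:url-4b091feeb646` Thm. 3.11 (ii) p. 156 l. 33–40 «certain natural inclusions “⊆”»;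
rp-plan's RP-I06 wording «q-pilot Kummer image ⊆ log-shell». LEVEL: none alone (holds at the countermodel). Reading choices: q-image ↦
`ρ qK`; log-shell ↦ the typed `shellPk` of line `n`. [claim: Mochizuki2012, status: disputed] -/
@[claim "Mochizuki2012" "disputed"]
def HQInShell : Prop := ∀ (j : T.Label) (vQ : T.VQ), ρ qK j vQ ⊆ (S.D P.n).shellPk j vQ

/-- **CANDIDATE RP-I06d, Θ-SIDE HALF `HShellInHull` (class Internal, B0) — hypothesis, NOT asserted; typed ≠ proved.** «The log-shell
ITSELF lies in the holomorphic hull ⁿ˒°𝒰_{j,v_ℚ} of the union of the possible Θ-pilot images»: `shellPk j v_ℚ ⊆ P.thetaHull j v_ℚ`. A Θ-SIDE-ONLY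
INFLATION CLAIM (does not read the q-datum). SOURCE STATUS: NOT-IN-PRINT — [IUTchIV] `paper:url-56bcb0f95768` Thm. 1.10 Step (v) p. 27
l. 57–71 bounds the hull from ABOVE by a log-shell multiple («… contains the “union of possible images of a Θ-pilot object” … (Ind3) is
taken into account by the fact that we are considering upper bounds»); no printed sentence puts the unit log-shell inside the hull. LEVEL H
jointly with `HQInShell`. [claim: Mochizuki2012, status: disputed] -/
@[claim "Mochizuki2012" "disputed"]
def HShellInHull : Prop := ∀ (j : T.Label) (vQ : T.VQ), (S.D P.n).shellPk j vQ ⊆ P.thetaHull j vQ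

/-- **CANDIDATE `H` := RP-I06d** = `HQInShell ∧ HShellInHull` («q-pilot Kummer image ⊆ log-shell ⊆ hull»). Hypothesis, NOT asserted.
[claim: Mochizuki2012, status: disputed] -/
@[claim "Mochizuki2012" "disputed"]
def H : Prop := HQInShell S P ρ qK ∧ HShellInHull S P

/-- **(T-a) at HULL level: `HQInShell → HShellInHull → Cor312Vol.PilotKummerCompatHull`** (two inclusions; nothing else is used).
[claim: Mochizuki2012, status: disputed] -/
theorem hull_of_H (hq : HQInShell S P ρ qK) (hs : HShellInHull S P) : PilotKummerCompatHull S P ρ qK :=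
  fun j vQ => (hq j vQ).trans (hs j vQ)

/-- **(T-a), Statement form**: bridge hypotheses + the q-pin + RP-I06d ⟹ the printed Statement (vehicle V-H, p420303).
[claim: Mochizuki2012, status: disputed] -/
theorem statement_of_H (HB : BridgeHyps P) (hpq : QPinned S P ρ qK) (h : H S P ρ qK) : P.Statement :=
  statement_of_pilotKummerCompatHull S P ρ qK HB hpq (hull_of_H S P ρ qK h.1 h.2)

/-- The director's shape with the THREE pins carried. [claim: Mochizuki2012, status: disputed] -/
theorem statement_of_pinned3_of_H (HB : BridgeHyps P) (hpin : PinnedRegions3 S P ρ qK) (h : H S P ρ qK) : P.Statement :=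
  statement_of_H S P ρ qK HB hpin.1.2 h

/-- RP-I06d gives the hull-level pinned residual `GapH3`. [claim: Mochizuki2012, status: disputed] -/
theorem gapH3_of_H (h : H S P ρ qK) : GapH3 S P ρ qK :=
  fun hpin => licence_of_pilotKummerCompatHull S P ρ qK hpin.1.2 (hull_of_H S P ρ qK h.1 h.2)

/-- The same from the typed Theorem 3.11 (carried, not consumed). [claim: Mochizuki2012, status: disputed] -/
theorem statement_of_thm311_of_pinned3_of_H (F : FullSituation T) (P : Cor312.Setting F.toLatticeSituation.toSituation)
    (ρ : (∀ v : T.V, v ∈ T.Vbad → Set (F.L.StarPacket v)) → ∀ (j : T.Label) (vQ : T.VQ), Set (F.L.Packet j vQ))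
    (qK : ∀ v : T.V, v ∈ T.Vbad → Set (F.L.StarPacket v)) (_hThm : F.Statement) (HB : BridgeHyps P)
    (hpin : PinnedRegions3 F.toLatticeSituation P ρ qK) (h : H F.toLatticeSituation P ρ qK) : P.Statement :=
  statement_of_pinned3_of_H F.toLatticeSituation P ρ qK HB hpin h

/-! ## 2. The class NO-GO for the inflation half under honest nesting -/

/-- Under honest NESTING (every possible Θ-image inside the q-image) the holomorphic hull of the union of the possible images lies inside
the q-image — the q-image is a hull-set (`Setting.qRegion_mem`) and the hull is the SMALLEST hull-set containing the union. [folklore] -/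
theorem thetaHull_subset_qRegion (hnest : ∀ (j : T.Label) (vQ : T.VQ), ∀ U ∈ P.possibleImages j vQ, U ⊆ P.qRegion j vQ)
    (j : T.Label) (vQ : T.VQ) : P.thetaHull j vQ ⊆ P.qRegion j vQ :=
  (P.frame j vQ).hull_subset_of_mem (P.qRegion_mem j vQ) (Set.sUnion_subset (hnest j vQ))

/-- **NO-GO, packet form.** Honest nesting (N) + monotone log-volume (M, `Cor312Vol.LogvolMono`) + admissible log-shell (A) + nonnegative
log-volume of the log-shell (Z, the normalisation `μ^log(𝒪) = 0 ≤ μ^log(𝓘)`) + `HShellInHull` ⟹ the q-volume is NONNEGATIVE in every packet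
of `𝔽_l^⋇`. [claim: Mochizuki2012, status: disputed] -/
theorem qLocal_nonneg_of_hShellInHull (hnest : ∀ (j : T.Label) (vQ : T.VQ), ∀ U ∈ P.possibleImages j vQ, U ⊆ P.qRegion j vQ)
    (hmono : LogvolMono P)
    (hadm : ∀ (i : Fin T.lstar) (vQ : T.VQ), (S.D P.n).Adm (Setting.labelSucc i) vQ ((S.D P.n).shellPk (Setting.labelSucc i) vQ))
    (hzero : ∀ (i : Fin T.lstar) (vQ : T.VQ), 0 ≤ (S.D P.n).logvol (Setting.labelSucc i) vQ ((S.D P.n).shellPk (Setting.labelSucc i) vQ))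
    (hs : HShellInHull S P) (i : Fin T.lstar) (vQ : T.VQ) : 0 ≤ P.qLocal (Setting.labelSucc i) vQ :=
  (hzero i vQ).trans (hmono i vQ (hadm i vQ) (P.hul_adm _ vQ _ (P.qRegion_mem _ vQ))
    ((hs _ vQ).trans (thetaHull_subset_qRegion S P hnest _ vQ)))

/-- **NO-GO, global form: under (N), (M), (A), (Z) the inflation half `HShellInHull` CONTRADICTS `|log(q)| > 0`** (`Cor312.Setting.AbsLogQPos`):
a procession-normalized average of sums of nonnegative packet volumes is nonnegative. So «log-shell ⊆ Θ-hull» can hold only where the possible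
Θ-images are NOT nested in the q-image — i.e. where the Θ-REGIONS are inflated beyond `q·𝒪` — never at a setting with honestly nested
(`j²`-scaled) Θ-images and a q-parameter of positive valuation. [claim: Mochizuki2012, status: disputed] -/
theorem not_absLogQPos_of_hShellInHull (hnest : ∀ (j : T.Label) (vQ : T.VQ), ∀ U ∈ P.possibleImages j vQ, U ⊆ P.qRegion j vQ)
    (hmono : LogvolMono P)
    (hadm : ∀ (i : Fin T.lstar) (vQ : T.VQ), (S.D P.n).Adm (Setting.labelSucc i) vQ ((S.D P.n).shellPk (Setting.labelSucc i) vQ))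
    (hzero : ∀ (i : Fin T.lstar) (vQ : T.VQ), 0 ≤ (S.D P.n).logvol (Setting.labelSucc i) vQ ((S.D P.n).shellPk (Setting.labelSucc i) vQ))
    (hs : HShellInHull S P) : ¬ P.AbsLogQPos := by
  have hall := qLocal_nonneg_of_hShellInHull S P hnest hmono hadm hzero hs
  have hl : 0 < T.lstar := lt_of_lt_of_le (by norm_num) T.two_le_lstar
  have h0 : (0 : ℝ) ≤ P.negLogQ := by
    unfold Setting.negLogQ
    calc (0 : ℝ) = processionNormalized (fun _ : Fin T.lstar => (0 : ℝ)) := (processionNormalized_const hl 0).symm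
      _ ≤ processionNormalized fun i : Fin T.lstar => ∑ᶠ vQ : T.VQ, P.qLocal (Setting.labelSucc i) vQ :=
        processionNormalized_mono fun i => finsum_nonneg fun vQ => hall i vQ
  exact fun hpos => absurd hpos (not_lt.mpr h0)

/-- Hence **RP-I06d as a whole is false wherever (N), (M), (A), (Z) and `|log(q)| > 0` hold** — the REPAIR-SPEC §6 shape «inflation
claim + faithful q-side fact» is confined, inside this class, to settings whose Θ-regions are inflated beyond the q-image.
[claim: Mochizuki2012, status: disputed] -/
theorem not_H_of_nested (hnest : ∀ (j : T.Label) (vQ : T.VQ), ∀ U ∈ P.possibleImages j vQ, U ⊆ P.qRegion j vQ)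
    (hmono : LogvolMono P)
    (hadm : ∀ (i : Fin T.lstar) (vQ : T.VQ), (S.D P.n).Adm (Setting.labelSucc i) vQ ((S.D P.n).shellPk (Setting.labelSucc i) vQ))
    (hzero : ∀ (i : Fin T.lstar) (vQ : T.VQ), 0 ≤ (S.D P.n).logvol (Setting.labelSucc i) vQ ((S.D P.n).shellPk (Setting.labelSucc i) vQ))
    (hpos : P.AbsLogQPos) : ¬ H S P ρ qK :=
  fun h => not_absLogQPos_of_hShellInHull S P hnest hmono hadm hzero h.2 hpos

end General

/-! ## 3. (T-b) and the LS-profile at the models of record -/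

section Toy

open Cor312.Checks Cor312.IdentifiedNonVacuity Cor312Vol.NaiveWitness Cor312Vol.PinnedWitness Cor312Vol.PinnedHonest

variable (p : ℕ) (d : ℕ) [hp : Fact p.Prime]

/-- **(T-b): the q-side half `HQInShell` HOLDS at the pinned countermodel** (`B_1 ⊆ B_0 = 𝒪`: the q-parameter is integral) ⇒ idle alone.
[folklore] -/
theorem hQInShell_pinnedSetting : HQInShell (naiveFull p).toLatticeSituation (pinnedSetting p) (orbitRegion p) (qDatum p) := by
  intro j vQ
  show orbitRegion p (qDatum p) j vQ ⊆ pBall p j vQ 0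
  by_cases hj : j = 0
  · subst hj; rw [orbitRegion_zero]
  · rw [orbitRegion_qDatum p hj]; exact pBall_mono p j vQ zero_le_one

omit hp in
/-- The honest NESTING (N) holds at the pinned countermodel: the only possible Θ-image `B_{j²}` lies in the q-image (`B_1` on `𝔽_l^⋇`, `B_0`
at the zero label). [folklore] -/
theorem nested_pinnedSetting (j : toyIndex.Label) (vQ : toyIndex.VQ) :
    ∀ U ∈ (pinnedSetting p).possibleImages j vQ, U ⊆ (pinnedSetting p).qRegion j vQ := by
  intro U hU
  rw [pinnedSetting_possibleImages, Set.mem_singleton_iff] at hU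
  subst hU
  by_cases hj : j = 0
  · subst hj; rw [pinnedSetting_qRegion_zero, jsq_zero]
  · rw [pinnedSetting_qRegion_of_ne_zero p hj]
    refine pBall_mono p j vQ ?_
    have h1 : (1 : ℕ) ≤ (j : ℕ) := Nat.one_le_iff_ne_zero.mpr fun h => hj (Fin.ext h)
    have : (1 : ℕ) ≤ (j : ℕ) ^ 2 := Nat.one_le_pow _ _ h1
    unfold jsq; exact_mod_cast this

/-- **(T-b): the inflation half `HShellInHull` FAILS at the pinned countermodel** — by the no-go of §2 (nesting, monotone ball volumes,
admissible log-shell `B_0` of volume `0`, `|log(q)| > 0` all hold there). [folklore] -/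
theorem not_hShellInHull_pinnedSetting : ¬ HShellInHull (naiveFull p).toLatticeSituation (pinnedSetting p) := fun hs =>
  not_absLogQPos_of_hShellInHull (naiveFull p).toLatticeSituation (pinnedSetting p) (nested_pinnedSetting p)
    (pinnedSetting_bridgeHyps p).mono (fun i vQ => ⟨0, rfl⟩)
    (fun i vQ => by show (0 : ℝ) ≤ pVol p _ vQ (pBall p _ vQ 0); rw [pVol_pBall]; simp) hs (pinnedSetting_absLogQPos p)

/-- **(T-b) for the row: RP-I06d FAILS at the pinned countermodel** (its inflation half does). [folklore] -/
theorem not_H_pinnedSetting : ¬ H (naiveFull p).toLatticeSituation (pinnedSetting p) (orbitRegion p) (qDatum p) :=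
  fun h => not_hShellInHull_pinnedSetting p h.2

omit hp in
/-- **REPAIR-SPEC §2 (3), literally at `p = 2`.** [folklore] -/
theorem H_at_pinned_countermodel :
    HQInShell (naiveFull 2).toLatticeSituation (pinnedSetting 2) (orbitRegion 2) (qDatum 2) ∧
      ¬ HShellInHull (naiveFull 2).toLatticeSituation (pinnedSetting 2) ∧
      ¬ H (naiveFull 2).toLatticeSituation (pinnedSetting 2) (orbitRegion 2) (qDatum 2) := by
  haveI : Fact (Nat.Prime 2) := ⟨Nat.prime_two⟩
  exact ⟨hQInShell_pinnedSetting 2, not_hShellInHull_pinnedSetting 2, not_H_pinnedSetting 2⟩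

/-- **The inflation half FAILS at the SAT+ model of record `flipSetting`** (w4-d103): there the Θ-images `B_{j²}` are honestly nested in the
q-image and `|log(q)| > 0`, so §2 applies (the inflated hull `B_1` does not reach the unit shell `B_0`). Hence RP-I06d is NOT SAT+-able by
abc-iut-w5-d068's engine P6. [folklore] -/
theorem not_hShellInHull_flip : ¬ HShellInHull (naiveFull p).toLatticeSituation (flipSetting p) := fun hs =>
  not_absLogQPos_of_hShellInHull (naiveFull p).toLatticeSituation (flipSetting p) (fun j vQ U hU => by
      rw [flip_possibleImages] at hU
      show U ⊆ (pinnedSetting p).qRegion j vQ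
      exact nested_pinnedSetting p j vQ U (by rw [pinnedSetting_possibleImages]; exact hU))
    (flip_bridgeHyps p).mono (fun i vQ => ⟨0, rfl⟩)
    (fun i vQ => by show (0 : ℝ) ≤ pVol p _ vQ (pBall p _ vQ 0); rw [pVol_pBall]; simp) hs (flip_absLogQPos p)

/-- The q-side half holds along the log-shell family LS (q-image `B_1`/`B_0` ⊆ `𝒪`). [folklore] -/
theorem hQInShell_shell : HQInShell (naiveFull p).toLatticeSituation (shellSetting p d) (rhoShell p d) (qDatum p) := by
  intro j vQ
  rw [rhoShell_qDatum]
  exact hQInShell_pinnedSetting p j vQ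

/-- **LS-PROFILE of the inflation half: `HShellInHull ↔ 4 ≤ d`** at `shellSetting p d` (hull `B_{j²−d} ⊇ B_0` at `j = 2` iff `d ≥ 4`: «inflation
≥ 4 × height», one more than RP-I06/RP-I06c's `3`). [folklore] -/
theorem hShellInHull_shell_iff : HShellInHull (naiveFull p).toLatticeSituation (shellSetting p d) ↔ 4 ≤ d := by
  have h2 : jsq (Setting.labelSucc (T := toyIndex) ⟨1, by decide⟩) = 4 := by decide
  constructor
  · intro hs
    have h := hs (Setting.labelSucc ⟨1, by decide⟩) ()
    rw [(shell_thetaHull p d _ ()).1, h2] at h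
    have h' : pBall p (Setting.labelSucc (T := toyIndex) ⟨1, by decide⟩) () 0 ⊆ pBall p _ () (4 - d) := h
    rw [pBall_subset_iff] at h'
    omega
  · intro hd j vQ
    show pBall p j vQ 0 ⊆ (shellSetting p d).thetaHull j vQ
    rw [(shell_thetaHull p d j vQ).1, pBall_subset_iff]
    have hj4 : jsq j ≤ 4 := by
      unfold jsq
      have hi : ((j : toyIndex.Label) : ℕ) ≤ 2 := Nat.le_of_lt_succ j.isLt
      have : ((j : toyIndex.Label) : ℕ) ^ 2 ≤ 2 ^ 2 := Nat.pow_le_pow_left hi 2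
      exact_mod_cast this
    omega

/-- **LS-PROFILE of the row: `H ↔ 4 ≤ d`.** [folklore] -/
theorem H_shell_iff : H (naiveFull p).toLatticeSituation (shellSetting p d) (rhoShell p d) (qDatum p) ↔ 4 ≤ d :=
  ⟨fun h => (hShellInHull_shell_iff p d).1 h.2, fun hd => ⟨hQInShell_shell p d, (hShellInHull_shell_iff p d).2 hd⟩⟩

omit hp d in
/-- **(T-c) for RP-I06d: satisfiable with the pins and the typed Thm. 3.11 at `shellSetting 2 4`** (grade SAT⊖ proposed: Θ-regions
`B_{j²−4}` inflated beyond the q-image, not exactly `j²`-scaled; q-volume label-independent and negative; not identified; GapH3 and the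
Statement hold, S fails). By §2 the row is never SAT+ (honest nesting excludes it). [folklore] -/
theorem H_satisfiable :
    ∃ (T : ThetaIndex) (F : FullSituation T) (P : Cor312.Setting F.toLatticeSituation.toSituation)
      (ρ : (∀ v : T.V, v ∈ T.Vbad → Set (F.L.StarPacket v)) → ∀ (j : T.Label) (vQ : T.VQ), Set (F.L.Packet j vQ))
      (qK : ∀ v : T.V, v ∈ T.Vbad → Set (F.L.StarPacket v)),
      F.Statement ∧ BridgeHyps P ∧ P.AbsLogQPos ∧ PinnedRegions3 F.toLatticeSituation P ρ qK ∧
      H F.toLatticeSituation P ρ qK ∧ GapH3 F.toLatticeSituation P ρ qK ∧ P.Statement ∧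
      ¬ PilotKummerIndRelated F.toLatticeSituation P ρ qK := by
  haveI : Fact (Nat.Prime 2) := ⟨Nat.prime_two⟩
  exact ⟨toyIndex, naiveFull 2, shellSetting 2 4, rhoShell 2 4, qDatum 2, naiveFull_statement 2, shell_bridgeHyps 2 4,
    shell_absLogQPos 2 4, rhoShell_pinnedRegions3 2 4, (H_shell_iff 2 4).2 le_rfl, (gapH3_shell_iff 2 4).2 (by norm_num),
    (shell_statement_iff 2 4).2 (by norm_num), not_pilotKummerIndRelated_shell 2 4⟩

/-! ## 4. The family form of RP-I06b's (T-c): UNSAT over every `naiveFull`-based setting -/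

omit d in
/-- **RP-I06b `HQShellOrbitData` is FALSE at EVERY setting over `naiveFull p` with the computed q-datum** — whatever the glue, the frame or
the operator: the typed log-shell of the family is `𝒪 = B_0`, the column's Θ-datum is `{(±q^{j²})_j}`, and `q ∉ ±q⁴·𝒪` at the label `j = 2`.
«UNSAT on the family of record» — not «contradicts the typed interface» (the typed Thm. 3.11 does not fix the log-shell index).
[folklore] -/
theorem not_hQShellOrbitData_naive (P : Cor312.Setting (naiveSituation p)) :
    ¬ HQShellOrbitData (naiveFull p).toLatticeSituation P (qDatum p) := by
  rintro ⟨m, hm⟩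
  have hq := hm () (Set.mem_univ _) (qTuple_mem_qDatum p ())
  rw [naiveFull_frobΨ] at hq
  have hdeep := shellSat_psi_deep p P.n () (Set.mem_univ _) _ hq
  have hl : line 2 (toyIndex.over ()) ((fun j : toyIndex.LabelStar => (line j.1 (toyIndex.over ())).symm (p : ℚ)) labTwo) = (p : ℚ) :=
    LinearEquiv.apply_symm_apply _ _
  rcases hdeep with h0 | h4
  · exact absurd (hl.symm.trans h0) (Nat.cast_ne_zero.mpr hp.out.ne_zero)
  · rw [hl, padicValRat.self hp.out.one_lt] at h4
    omega

end Toy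

end Summit.ABC.IUTFork.Repair.CandInternal8

end
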